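import Summits.CriticalPhenomena.PercolationContinuityZ3.Theorems.Transplant.AutChartOrbitsDatum
import HarnessLib

/-!
# The chart datum of an action by automorphisms with FINITELY MANY ORBITS, II: (κ′) the cylinders at every representative are connected from some
# width on; THE MULTI-TYPE SCALED SKELETON — base types = the transversal, `L = N`, chart-aligned

builds on p205010 (kernel theorem, internal audit signed; external expert review pending) — nothing in this file uses p205010; nothing here is a claim
about any open node.  Lane `prim-bschramm`, seat `prim-bschramm-p3` gen 28 (design owner; NEXT-SCOPE (N3), the action / orbit side).  Helper file
(`--supports stmt-CriticalPhenomena-4575 --as helper`).  Sequel of «AutChartOrbitsDatum» (the `OrbitDatum`, its chart, boxed and kernel walks).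

(κ′) exactly as for transitive actions («AutChartCylinders») but with SEVERAL base types: reduce both chart coordinates into `[0, N)` by exact-step edges
inside the cylinder (`reduce_coord`; the steps exist at every vertex, `OrbitDatum.step_at`), then join the reduced vertex `v` to the base `r` inside
`Λ_{ℓ₀}`, `ℓ₀ = N·D_reps + N·R₁ + N + N·m`: walk to the TYPE `r' = typ v` of `v` (radius `N·D_reps`, `D_reps` bounding the distances between
representatives), a KERNEL walk from `r'` to `k • r'` (radius `N m`), and the `k`-translate of a walk from `r'` to the representative vertex of type `r'`
with the chart value of `v` (radius `N R₁`).  Then **`OrbitDatum.skeleton : PlanarSkeletonFrmScaled G`** with `types = reps`, chart `ψ ∘ sec`,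
`L = N` DEFINITIONALLY (`skeleton_L_le_N`), frames `a • ·`, exact `N`-steps, cylinders connected from `ℓ₀` on, and **`skeleton_aligned`**: the pairwise
chart-alignment hypothesis of gen-1 g3's aligned multi-type scaled node «SkelFrmScaledAlignedHoldsAll» (p490798), met with `α := 1 • ·` because the
chart vanishes on every representative.
[cite: KozmaNitzan2024, §4 pp. 15–16 (boxes; Lemma 8)] [cite: MartineauTassion2017, §3.2] [cite: BenjaminiSchramm1996, §2 (almost transitive graphs)]
-/

noncomputable section

namespace Summit.CriticalPhenomena.PercolationContinuityZ3.Theorems.Transplant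

open SimpleGraph Filter Literature.Barriers.CriticalPhenomena Literature.Probability.LatticeModels Literature.Probability.Percolation
open scoped Classical

namespace AutChart

variable {V : Type} {G : SimpleGraph V} {A : Type} [Group A] [MulAction A V]

namespace OrbitDatum

/-! ### Radii: distances between representatives, and the representatives' radius of the reduced chart values -/

/-- Every vertex is at finite distance from every vertex. [folklore] -/
theorem exists_rad (D : OrbitDatum G A) (u v : V) : ∃ n : ℕ, v ∈ graphBall G u n := by
  obtain ⟨w⟩ := D.conn.preconnected u v
  exact ⟨w.length, w, le_rfl⟩

/-- A radius at which `v` is seen from `u`. [folklore] -/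
def rad (D : OrbitDatum G A) (u v : V) : ℕ := Classical.choose (D.exists_rad u v)

/-- `v ∈ B(u, rad u v)`. [folklore] -/
theorem mem_graphBall_rad (D : OrbitDatum G A) (u v : V) : v ∈ graphBall G u (D.rad u v) := Classical.choose_spec (D.exists_rad u v)

/-- **A bound for the distances between representatives.** [folklore] -/
def Drep (D : OrbitDatum G A) : ℕ := D.reps.sup fun r => D.reps.sup fun r' => D.rad r r'

/-- `rad r r' ≤ Drep` on the transversal. [folklore] -/
theorem rad_le_Drep (D : OrbitDatum G A) {r r' : V} (hr : r ∈ D.reps) (hr' : r' ∈ D.reps) : D.rad r r' ≤ D.Drep :=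
  le_trans (Finset.le_sup (f := fun r'' => D.rad r r'') hr') (Finset.le_sup (f := fun r => D.reps.sup fun r'' => D.rad r r'') hr)

/-- **The representatives' radius**: every reduced chart value occurring in a type has a representative vertex of that type in `B(type, R₁)`. [folklore] -/
def R1 (D : OrbitDatum G A) : ℕ := D.reps.sup fun r' => ((Finset.range D.N) ×ˢ (Finset.range D.N)).sup fun ab =>
  if h : ∃ v : V, D.typ v = r' ∧ D.chart v = CayleyScaled.vec ab.1 ab.2 then D.rad r' (Classical.choose h) else 0

/-- **The width floor `ℓ₀ = N D_reps + N R₁ + N + N m`.** [folklore] -/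
def ℓ₀ (D : OrbitDatum G A) : ℕ := D.N * D.Drep + D.N * D.R1 + D.N + D.N * D.m

/-- **A reduced vertex (`φ ∈ [0, N)²`) is joined to EVERY representative inside the box of radius `ℓ₀`**: go to the vertex's type, take a kernel walk to
`k • type`, then the `k`-translate of a walk to the representative vertex of its chart value. [folklore] -/
theorem inBox_of_reduced (D : OrbitDatum G A) {r : V} (hr : r ∈ D.reps) {v : V} (hv : ∀ i : Fin 2, 0 ≤ D.chart v i ∧ D.chart v i < D.N) :
    D.InBox D.ℓ₀ r v := by
  set r' : V := D.typ v with hr'_def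
  have hr' : r' ∈ D.reps := D.typ_mem v
  set a : ℕ := (D.chart v 0).toNat with ha
  set b : ℕ := (D.chart v 1).toNat with hb
  have h0 := hv 0
  have h1 := hv 1
  have hφv : D.chart v = CayleyScaled.vec a b := by
    funext i; fin_cases i
    · show D.chart v 0 = ((D.chart v 0).toNat : ℤ); rw [Int.toNat_of_nonneg h0.1]
    · show D.chart v 1 = ((D.chart v 1).toNat : ℤ); rw [Int.toNat_of_nonneg h1.1]
  have hex : ∃ v' : V, D.typ v' = r' ∧ D.chart v' = CayleyScaled.vec a b := ⟨v, rfl, hφv⟩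
  set ρ : V := Classical.choose hex with hρ
  have hρ' : D.typ ρ = r' ∧ D.chart ρ = CayleyScaled.vec a b := Classical.choose_spec hex
  have hab : (a, b) ∈ (Finset.range D.N) ×ˢ (Finset.range D.N) := by
    rw [Finset.mem_product, Finset.mem_range, Finset.mem_range]
    constructor
    · have : (a : ℤ) < D.N := by rw [ha, Int.toNat_of_nonneg h0.1]; exact h0.2
      exact_mod_cast this
    · have : (b : ℤ) < D.N := by rw [hb, Int.toNat_of_nonneg h1.1]; exact h1.2
      exact_mod_cast this
  have hrad : D.rad r' ρ ≤ D.R1 := by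
    have h := Finset.le_sup (f := fun ab : ℕ × ℕ => if h : ∃ v' : V, D.typ v' = r' ∧ D.chart v' = CayleyScaled.vec ab.1 ab.2
      then D.rad r' (Classical.choose h) else 0) hab
    simp only [dif_pos hex] at h
    exact le_trans h (Finset.le_sup (f := fun r'' => ((Finset.range D.N) ×ˢ (Finset.range D.N)).sup fun ab =>
      if h : ∃ v' : V, D.typ v' = r'' ∧ D.chart v' = CayleyScaled.vec ab.1 ab.2 then D.rad r'' (Classical.choose h) else 0) hr')
  -- the kernel element carrying `ρ` to `v`
  set k : A := D.sec v * (D.sec ρ)⁻¹ with hk_def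
  have hk : D.ψ k = 0 := by
    rw [hk_def, D.ψ_mul, D.ψ_inv, ← D.chart_eq, ← D.chart_eq, hφv, hρ'.2, add_neg_cancel]
  have hρr : (D.sec ρ)⁻¹ • ρ = r' := by rw [inv_smul_eq_iff, ← hρ'.1, D.sec_smul]
  have hkr : k • ρ = v := by rw [hk_def, mul_smul, hρr, hr'_def, D.sec_smul]
  have hA : D.InBox (D.N * D.Drep) r r' :=
    D.inBox_mono (Nat.mul_le_mul_left _ (D.rad_le_Drep hr hr')) (D.inBox_of_mem_graphBall hr (D.mem_graphBall_rad r r'))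
  have hB : D.InBox (D.N * D.m) r' (k • r') := D.ker_inBox hr' hk
  have hC : D.InBox (D.N * D.R1) r' ρ := D.inBox_mono (Nat.mul_le_mul_left _ hrad) (D.inBox_of_mem_graphBall hr' (D.mem_graphBall_rad r' ρ))
  have hC' := D.inBox_smul k (S := 0) (fun i => by rw [hk, Pi.zero_apply, abs_zero]; rfl) hC
  rw [Nat.zero_add, hkr] at hC'
  exact D.inBox_trans (D.inBox_mono (by unfold ℓ₀; omega) hA)
    (D.inBox_trans (D.inBox_mono (by unfold ℓ₀; omega) hB) (D.inBox_mono (by unfold ℓ₀; omega) hC'))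

/-- The deviation of a chart coordinate from the block `[0, N)` (a termination measure for the reduction). [folklore] -/
def excess (D : OrbitDatum G A) (x : ℤ) : ℕ := (-x).toNat + (x - D.N + 1).toNat

/-- **Reduction of ONE coordinate inside the cylinder at a representative**: from any vertex of the cylinder `‖φ‖_∞ ≤ ℓ` (`ℓ ≥ N`), single exact-step
edges lead, inside the cylinder, to a vertex whose `i`-th chart coordinate lies in `[0, N)` and whose other coordinate is unchanged. [folklore] -/
theorem reduce_coord (D : OrbitDatum G A) {r : V} (hr : r ∈ D.reps) (i : Fin 2) {ℓ : ℕ} (hℓ : D.N ≤ ℓ) :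
    ∀ (n : ℕ) (v : V) (hvm : v ∈ {w | D.chart w - D.chart r ∈ box 2 ℓ}), D.excess (D.chart v i) ≤ n →
      ∃ (v' : V) (hv'm : v' ∈ {w | D.chart w - D.chart r ∈ box 2 ℓ}),
        (0 ≤ D.chart v' i ∧ D.chart v' i < D.N) ∧ (∀ j, j ≠ i → D.chart v' j = D.chart v j) ∧
        (G.induce {w | D.chart w - D.chart r ∈ box 2 ℓ}).Reachable ⟨v, hvm⟩ ⟨v', hv'm⟩ := by
  intro n
  induction n with
  | zero =>
    intro v hvm hex
    refine ⟨v, hvm, ?_, fun j _ => rfl, Reachable.refl _⟩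
    unfold excess at hex
    constructor <;> omega
  | succ n ih =>
    intro v hvm hex
    by_cases hin : 0 ≤ D.chart v i ∧ D.chart v i < D.N
    · exact ⟨v, hvm, hin, fun j _ => rfl, Reachable.refl _⟩
    · have hvbox : D.chart v ∈ box 2 ℓ := by
        have := hvm; simp only [Set.mem_setOf_eq, D.chart_of_mem hr, sub_zero] at this; exact this
      rw [mem_box] at hvbox
      by_cases hneg : D.chart v i < 0
      · obtain ⟨v₁, hadj, hφ₁⟩ := D.step_pos v i
        have hφ₁i : D.chart v₁ i = D.chart v i + D.N := by rw [hφ₁, Pi.add_apply, Pi.single_eq_same]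
        have hφ₁j : ∀ j, j ≠ i → D.chart v₁ j = D.chart v j := fun j hj => by
          rw [hφ₁, Pi.add_apply, Pi.single_eq_of_ne hj, add_zero]
        have hv₁m : v₁ ∈ {w | D.chart w - D.chart r ∈ box 2 ℓ} := by
          show D.chart v₁ - D.chart r ∈ box 2 ℓ
          rw [D.chart_of_mem hr, sub_zero, mem_box]
          intro j
          by_cases hj : j = i
          · subst hj; rw [hφ₁i]; have := hvbox j; constructor <;> omega
          · rw [hφ₁j j hj]; exact hvbox j
        have hex₁ : D.excess (D.chart v₁ i) ≤ n := by
          have hN1 := D.one_le_N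
          rw [hφ₁i]; unfold excess at hex ⊢; omega
        obtain ⟨v', hv'm, hv'in, hv'j, hreach⟩ := ih v₁ hv₁m hex₁
        refine ⟨v', hv'm, hv'in, fun j hj => by rw [hv'j j hj, hφ₁j j hj], ?_⟩
        have hadj' : (G.induce {w | D.chart w - D.chart r ∈ box 2 ℓ}).Adj ⟨v, hvm⟩ ⟨v₁, hv₁m⟩ := induce_adj.2 hadj
        exact hadj'.reachable.trans hreach
      · have hge : (D.N : ℤ) ≤ D.chart v i := by
          push Not at hneg
          by_contra hlt; push Not at hlt; exact hin ⟨hneg, hlt⟩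
        obtain ⟨v₁, hadj, hφ₁⟩ := D.step_neg v i
        have hφ₁i : D.chart v₁ i = D.chart v i - D.N := by rw [hφ₁, Pi.sub_apply, Pi.single_eq_same]
        have hφ₁j : ∀ j, j ≠ i → D.chart v₁ j = D.chart v j := fun j hj => by
          rw [hφ₁, Pi.sub_apply, Pi.single_eq_of_ne hj, sub_zero]
        have hv₁m : v₁ ∈ {w | D.chart w - D.chart r ∈ box 2 ℓ} := by
          show D.chart v₁ - D.chart r ∈ box 2 ℓ
          rw [D.chart_of_mem hr, sub_zero, mem_box]
          intro j
          by_cases hj : j = i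
          · subst hj; rw [hφ₁i]; have := hvbox j; constructor <;> omega
          · rw [hφ₁j j hj]; exact hvbox j
        have hex₁ : D.excess (D.chart v₁ i) ≤ n := by
          have hN1 := D.one_le_N
          rw [hφ₁i]; unfold excess at hex ⊢; omega
        obtain ⟨v', hv'm, hv'in, hv'j, hreach⟩ := ih v₁ hv₁m hex₁
        refine ⟨v', hv'm, hv'in, fun j hj => by rw [hv'j j hj, hφ₁j j hj], ?_⟩
        have hadj' : (G.induce {w | D.chart w - D.chart r ∈ box 2 ℓ}).Adj ⟨v, hvm⟩ ⟨v₁, hv₁m⟩ := induce_adj.2 hadj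
        exact hadj'.reachable.trans hreach

/-- **(κ′) THE CYLINDERS `{φ − φ r ∈ Λ_ℓ}` AT EVERY REPRESENTATIVE, `ℓ ≥ ℓ₀`, ARE CONNECTED** (reduce both coordinates by exact steps inside the
cylinder, then join the reduced vertex to `r` inside the box of radius `ℓ₀`). [cite: KozmaNitzan2024, §4 p. 15 (boxes)] -/
theorem cyl_connected_of_le (D : OrbitDatum G A) {r : V} (hr : r ∈ D.reps) {ℓ : ℕ} (hℓ : D.ℓ₀ ≤ ℓ) :
    (G.induce {w | D.chart w - D.chart r ∈ box 2 ℓ}).Connected := by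
  have hNℓ : D.N ≤ ℓ := le_trans (by unfold ℓ₀; omega) hℓ
  have ht : r ∈ {w | D.chart w - D.chart r ∈ box 2 ℓ} := by
    show D.chart r - D.chart r ∈ box 2 ℓ; rw [sub_self]; exact zero_mem_box 2 ℓ
  have key : ∀ x : {w | D.chart w - D.chart r ∈ box 2 ℓ}, (G.induce {w | D.chart w - D.chart r ∈ box 2 ℓ}).Reachable ⟨r, ht⟩ x := by
    rintro ⟨v, hvm⟩
    obtain ⟨v₁, hv₁m, hv₁in, _, hr₁⟩ := D.reduce_coord hr 0 hNℓ _ v hvm le_rfl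
    obtain ⟨v₂, hv₂m, hv₂in, hv₂j, hr₂⟩ := D.reduce_coord hr 1 hNℓ _ v₁ hv₁m le_rfl
    have hred : ∀ i : Fin 2, 0 ≤ D.chart v₂ i ∧ D.chart v₂ i < D.N := by
      intro i
      fin_cases i
      · show 0 ≤ D.chart v₂ 0 ∧ D.chart v₂ 0 < D.N
        rw [hv₂j 0 (by decide)]; exact hv₁in
      · exact hv₂in
    exact (D.reach_of_inBox hr hℓ (D.inBox_of_reduced hr hred) ht hv₂m).trans (hr₁.trans hr₂).symm
  exact (connected_iff _).2 ⟨fun a b => (key a).symm.trans (key b), ⟨⟨r, ht⟩⟩⟩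

/-! ### The multi-type scaled skeleton of `G` -/

/-- **THE MULTI-TYPE SCALED SKELETON OF `G` from an orbit datum**: chart `ψ ∘ sec` (zero offsets), `L = N`, base types `reps`, frames `a • ·`, exact
`N`-steps along single edges, cylinders connected from `ℓ₀` on. [cite: KozmaNitzan2024, §4 p. 16 (Lemma 8)] [cite: MartineauTassion2017, §3.2] -/
def skeleton [G.LocallyFinite] (D : OrbitDatum G A) : PlanarSkeletonFrmScaled G where
  φ := D.chart
  L := D.N
  lip := fun _ _ huv i => D.chart_lip huv i
  types := D.reps
  frame := fun v => ⟨D.typ v, D.typ_mem v, smulIso D.act (D.sec v), D.sec_smul v, fun w => by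
    rw [smulIso_apply, D.chart_smul, D.chart_typ, sub_zero, add_comm]
    rfl⟩
  Δ := D.reps.sup fun r => G.degree r
  degree_le := fun v => by
    have e : G.degree (D.sec v • D.typ v) = G.degree (D.typ v) := by rw [← smulIso_apply D.act (D.sec v) (D.typ v), Iso.degree_eq]
    rw [D.sec_smul] at e
    rw [e]
    exact Finset.le_sup (f := fun r => G.degree r) (D.typ_mem v)
  N := D.N
  one_le_N := D.one_le_N
  step := D.step_at
  ℓ₀ := D.ℓ₀
  cyl_connected := fun _ hr _ hℓ => D.cyl_connected_of_le hr hℓ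

/-- The skeleton's base types are the representatives. [folklore] -/
@[simp] theorem skeleton_types [G.LocallyFinite] (D : OrbitDatum G A) : D.skeleton.types = D.reps := rfl

/-- The skeleton's chart is the datum's chart. [folklore] -/
@[simp] theorem skeleton_φ [G.LocallyFinite] (D : OrbitDatum G A) : D.skeleton.φ = D.chart := rfl

/-- The skeleton's Lipschitz constant is `N`. [folklore] -/
@[simp] theorem skeleton_L [G.LocallyFinite] (D : OrbitDatum G A) : D.skeleton.L = D.N := rfl

/-- The skeleton's step length is `N`. [folklore] -/
@[simp] theorem skeleton_N [G.LocallyFinite] (D : OrbitDatum G A) : D.skeleton.N = D.N := rfl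

/-- **The rider is free**: `L ≤ N` for the orbit skeleton (`L = N`). [folklore] -/
theorem skeleton_L_le_N [G.LocallyFinite] (D : OrbitDatum G A) : D.skeleton.L ≤ D.skeleton.N := le_rfl

/-- **THE BASE TYPES ARE CHART-ALIGNED** (pairwise form of «SkelFrmScaledAlignedHoldsAll»): all representatives have chart `0`, so `α := 1 • ·` translates
the chart by `φ s − φ s' = 0`. [this work] -/
theorem skeleton_aligned [G.LocallyFinite] (D : OrbitDatum G A) :
    ∀ s ∈ D.skeleton.types, ∀ s' ∈ D.skeleton.types, ∃ α : G ≃g G, ∀ w, D.skeleton.φ (α w) = D.skeleton.φ w + (D.skeleton.φ s - D.skeleton.φ s') := by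
  intro s hs s' hs'
  rw [skeleton_types] at hs hs'
  refine ⟨smulIso D.act 1, fun w => ?_⟩
  rw [skeleton_φ, smulIso_apply, one_smul, D.chart_of_mem hs, D.chart_of_mem hs', sub_zero, add_zero]

/-- Single-base form of the alignment at any representative `t`. [this work] -/
theorem skeleton_aligned_at [G.LocallyFinite] (D : OrbitDatum G A) {t : V} (ht : t ∈ D.reps) :
    ∀ s ∈ D.skeleton.types, ∃ α : G ≃g G, ∀ w, D.skeleton.φ (α w) = D.skeleton.φ w + (D.skeleton.φ s - D.skeleton.φ t) :=
  fun s hs => D.skeleton_aligned s hs t (by rw [skeleton_types]; exact ht)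

end OrbitDatum

end AutChart

end Summit.CriticalPhenomena.PercolationContinuityZ3.Theorems.Transplant

end
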